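import Summits.NavierStokesRegularity.NavierStokesRegularity.Theorems.EulerZoomLiouvillePowerGaugeEulerLiouvilleWeakRenormalizedTransportTools

/-!
# RENORMALISED similarity-Bernoulli transport IN THE WEAK CLASS, II: `div(β(ℋ)W) = 3γβ(ℋ) − (1−2γ)β′(ℋ)|W|²` in `𝒟′(ℝ³)`
# and «THE BERNOULLI HIGH SETS ARE BACKWARD-INVARIANT» in Eulerian form — no regularity, no flow
# (crux `EulerZoomLiouville.PowerGaugeEulerLiouville` = stmt-NavierStokesRegularity-19832, line `birth`, open stub `stub_selfSimilarWeakRest`)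

Width seat `ns-ezl-w1` (g7) under the crux LEAD.  Sequel of `…WeakRenormalizedTransportTools` (product rule `div(fW) = ⟪∇f,W⟫ + 3γf`,
smooth steps), of g6's `…WeakBernoulliGradient` (Lamb form CIV (3.29) a.e.) and of the tree's Sobolev chain rule
`Wu2026Salvage.hasWeakFDerivOn_comp_of_deriv_bound`.  In the `C²` stratum every needle argument starts from the Lagrangian fact «`ℋ` is
non-decreasing along backward similarity orbits, so every high set `{ℋ > h}` is backward-invariant» (CIV (3.31)–(3.33)); the genuinely
weak stratum has no flow, and this file gives the Eulerian substitute for profiles WITHOUT ANY REGULARITY (`V ∈ L⁶_loc`, `G ∈ L²_loc`,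
`P ∈ L^{3/2}_loc`, weakly divergence free, Lamb form — all supplied by a weak class member, `…WeakRenormalizedTransportMember`):

* **`WeakRenormalized.renormalized_transport_law`** — for every `β ∈ C¹(ℝ)` with `‖β′‖_∞ < ∞` and every test function `θ`:
  `∫ β(ℋ) ⟪W, ∇θ⟫ = −3γ ∫ θ β(ℋ) + (1 − 2γ) ∫ θ β′(ℋ) |W|²` — the RENORMALISATION property of the similarity transport of `ℋ`
  (for `β = id` this is g6's `WeakBernoulli.weak_transport_law`; the renormalised form needs the chain rule and is new);
* `WeakRenormalized.renormalized_transport_ineq` — `γ ≤ ½`, `β′ ≥ 0`, `θ ≥ 0` ⇒ `−3γ ∫ θ β(ℋ) ≤ ∫ β(ℋ)⟪W, ∇θ⟫`;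
* **`WeakRenormalized.highSet_transport_ineq`** — for `γ ≤ ½`, every level `h` and every test function `θ ≥ 0`:
  `−3γ ∫_{ℋ > h} θ ≤ ∫_{ℋ > h} ⟪W, ∇θ⟫`, i.e. `div(𝟙_{ℋ>h} W) ≤ 𝟙_{ℋ>h} div W` in `𝒟′(ℝ³)` (monotone limit through the smooth steps).

WHAT THIS IS NOT: not NS, not E, not the stub — weak-class TOOLS (`--supports` stmt-19832); no summit statement is proved here.
[folklore; cf. ConstantinIgnatovaVicol2026Putative §3.4.3 (3.29)–(3.33); Evans2010 §5.10 Problem 17; GilbargTrudinger2001 Lemma 7.5]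
-/

noncomputable section

set_option linter.dupNamespace false
-- nested operator types (`innerSL … ∘L …`)
set_option maxSynthPendingDepth 3

open MeasureTheory Set Filter Topology Metric Function TopologicalSpace
open scoped ENNReal NNReal RealInnerProductSpace ContDiff

namespace Summit.NavierStokesRegularity.NavierStokesRegularity.Theorems.PowerGaugeEulerLiouville

open Literature.Analysis Literature.Analysis.FunctionSpaces Literature.Analysis.FluidPDE

namespace WeakRenormalized

variable {V : EuclideanSpace ℝ (Fin 3) → EuclideanSpace ℝ (Fin 3)} {P : EuclideanSpace ℝ (Fin 3) → ℝ}
  {G : EuclideanSpace ℝ (Fin 3) → EuclideanSpace ℝ (Fin 3) →L[ℝ] EuclideanSpace ℝ (Fin 3)}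

/-! ## Integrability of `W`, `ℋ`, `∇ℋ` on balls from the class data -/

section Integrability

/-- `W = γy + V ∈ L⁶(B(0,R))` when `V ∈ L⁶(B(0,R))`. [folklore] -/
theorem memLp_transport_six {γ R : ℝ} (hV6 : MemLp V 6 (volume.restrict (ball (0 : EuclideanSpace ℝ (Fin 3)) R))) :
    MemLp (selfSimilarTransport γ 0 V) 6 (volume.restrict (ball (0 : EuclideanSpace ℝ (Fin 3)) R)) := by
  haveI : IsFiniteMeasure ((volume : Measure (EuclideanSpace ℝ (Fin 3))).restrict (ball 0 R)) :=
    isFiniteMeasure_restrict.2 measure_ball_lt_top.ne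
  have hlin : MemLp (fun x : EuclideanSpace ℝ (Fin 3) => γ • (x - 0)) 6
      (volume.restrict (ball (0 : EuclideanSpace ℝ (Fin 3)) R)) := by
    refine MemLp.of_bound (by fun_prop : Continuous fun x : EuclideanSpace ℝ (Fin 3) => γ • (x - 0)).aestronglyMeasurable
      (|γ| * R) ?_
    filter_upwards [ae_restrict_mem measurableSet_ball] with x hx
    rw [mem_ball, dist_zero_right] at hx
    rw [norm_smul, Real.norm_eq_abs, sub_zero]
    exact mul_le_mul_of_nonneg_left hx.le (abs_nonneg _)
  have h := hlin.add hV6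
  have e : ((fun x : EuclideanSpace ℝ (Fin 3) => γ • (x - 0)) + V) = selfSimilarTransport γ 0 V := by
    funext x; rfl
  rwa [e] at h

/-- `ℋ = ½|W|² + P + ½γ(γ−1)|y|² ∈ L^{3/2}(B(0,R))` when `V ∈ L⁶(B(0,R))`, `P ∈ L^{3/2}(B(0,R))`. [folklore] -/
theorem memLp_bernoulli_threeHalves {γ R : ℝ} (hV6 : MemLp V 6 (volume.restrict (ball (0 : EuclideanSpace ℝ (Fin 3)) R)))
    (hP : MemLp P (3 / 2 : ℝ≥0∞) (volume.restrict (ball (0 : EuclideanSpace ℝ (Fin 3)) R))) :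
    MemLp (selfSimilarBernoulli γ 0 V P) (3 / 2 : ℝ≥0∞) (volume.restrict (ball (0 : EuclideanSpace ℝ (Fin 3)) R)) := by
  haveI : IsFiniteMeasure ((volume : Measure (EuclideanSpace ℝ (Fin 3))).restrict (ball 0 R)) :=
    isFiniteMeasure_restrict.2 measure_ball_lt_top.ne
  have hW := memLp_transport_six (γ := γ) hV6
  have hsq3 : MemLp (fun x => ‖selfSimilarTransport γ 0 V x‖ ^ 2) 3
      (volume.restrict (ball (0 : EuclideanSpace ℝ (Fin 3)) R)) := by
    have h := hW.norm_rpow_div (2 : ℝ≥0∞)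
    have e : (6 : ℝ≥0∞) / 2 = 3 := by
      symm; rw [ENNReal.eq_div_iff (by norm_num) (by norm_num)]; norm_num
    rw [e] at h
    refine h.congr_norm (hW.1.norm.pow 2) (Eventually.of_forall fun x => ?_)
    simp only [ENNReal.toReal_ofNat, Real.rpow_two, norm_pow, norm_norm]
  have h1 : MemLp (fun x => (1 / 2 : ℝ) * ‖selfSimilarTransport γ 0 V x‖ ^ 2) (3 / 2 : ℝ≥0∞)
      (volume.restrict (ball (0 : EuclideanSpace ℝ (Fin 3)) R)) :=
    (hsq3.mono_exponent (by
      rw [ENNReal.div_le_iff (by norm_num) (by norm_num)]; norm_num)).const_mul _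
  have h3 : MemLp (fun x : EuclideanSpace ℝ (Fin 3) => γ * (γ - 1) / 2 * ‖x - 0‖ ^ 2) (3 / 2 : ℝ≥0∞)
      (volume.restrict (ball (0 : EuclideanSpace ℝ (Fin 3)) R)) := by
    refine MemLp.of_bound (by fun_prop : Continuous fun x : EuclideanSpace ℝ (Fin 3) =>
      γ * (γ - 1) / 2 * ‖x - 0‖ ^ 2).aestronglyMeasurable (|γ * (γ - 1) / 2| * R ^ 2) ?_
    filter_upwards [ae_restrict_mem measurableSet_ball] with x hx
    rw [mem_ball, dist_zero_right] at hx
    rw [norm_mul, Real.norm_eq_abs, Real.norm_eq_abs, sub_zero, abs_pow, abs_norm]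
    exact mul_le_mul_of_nonneg_left (pow_le_pow_left₀ (norm_nonneg _) hx.le 2) (abs_nonneg _)
  have h := (h1.add hP).add h3
  have e : (((fun x => (1 / 2 : ℝ) * ‖selfSimilarTransport γ 0 V x‖ ^ 2) + P) +
      fun x : EuclideanSpace ℝ (Fin 3) => γ * (γ - 1) / 2 * ‖x - 0‖ ^ 2) = selfSimilarBernoulli γ 0 V P := by
    funext x; rfl
  rwa [e] at h

/-- The Lamb-form gradient `x ↦ (2γ−1)⟪W x, ·⟫ + ⟪W x, G x ·⟫ − ⟪G x (W x), ·⟫` lies in `L^{3/2}(B(0,R))` when `V ∈ L⁶(B(0,R))`,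
`G ∈ L²(B(0,R))` (norm `≤ (|2γ−1| + 2‖G‖)‖W‖`, Hölder `6⁻¹ + 2⁻¹ = (3/2)⁻¹`). [folklore] -/
theorem memLp_bernoulliGradient_threeHalves {γ R : ℝ}
    (hV6 : MemLp V 6 (volume.restrict (ball (0 : EuclideanSpace ℝ (Fin 3)) R)))
    (hG2 : MemLp G 2 (volume.restrict (ball (0 : EuclideanSpace ℝ (Fin 3)) R)))
    (hgm : AEStronglyMeasurable (fun x => (2 * γ - 1) • innerSL ℝ (selfSimilarTransport γ 0 V x) +
        (innerSL ℝ (selfSimilarTransport γ 0 V x)).comp (G x) - innerSL ℝ (G x (selfSimilarTransport γ 0 V x)))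
      (volume.restrict (ball (0 : EuclideanSpace ℝ (Fin 3)) R))) :
    MemLp (fun x => (2 * γ - 1) • innerSL ℝ (selfSimilarTransport γ 0 V x) +
        (innerSL ℝ (selfSimilarTransport γ 0 V x)).comp (G x) - innerSL ℝ (G x (selfSimilarTransport γ 0 V x)))
      (3 / 2 : ℝ≥0∞) (volume.restrict (ball (0 : EuclideanSpace ℝ (Fin 3)) R)) := by
  haveI : IsFiniteMeasure ((volume : Measure (EuclideanSpace ℝ (Fin 3))).restrict (ball 0 R)) :=
    isFiniteMeasure_restrict.2 measure_ball_lt_top.ne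
  haveI := ProfileEnergy.holderTriple_two_six_threeHalves
  have hW := memLp_transport_six (γ := γ) hV6
  -- the dominating function `(|2γ−1| + 2‖G‖)·‖W‖ ∈ L^{3/2}`
  have hc0 : MemLp (fun _ : EuclideanSpace ℝ (Fin 3) => |2 * γ - 1|) 2 (volume.restrict (ball (0 : EuclideanSpace ℝ (Fin 3)) R)) :=
    memLp_const _
  have hG2n : MemLp (fun x => 2 * ‖G x‖) 2 (volume.restrict (ball (0 : EuclideanSpace ℝ (Fin 3)) R)) :=
    hG2.norm.const_mul 2
  have hc2 : MemLp (fun x => |2 * γ - 1| + 2 * ‖G x‖) 2 (volume.restrict (ball (0 : EuclideanSpace ℝ (Fin 3)) R)) :=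
    hc0.add hG2n
  have hdom : MemLp (fun x => (|2 * γ - 1| + 2 * ‖G x‖) * ‖selfSimilarTransport γ 0 V x‖) (3 / 2 : ℝ≥0∞)
      (volume.restrict (ball (0 : EuclideanSpace ℝ (Fin 3)) R)) := by
    have hWn : MemLp (fun x => ‖selfSimilarTransport γ 0 V x‖) 6 (volume.restrict (ball (0 : EuclideanSpace ℝ (Fin 3)) R)) :=
      hW.norm
    exact MemLp.mul (p := 2) (q := 6) (r := (3 / 2 : ℝ≥0∞)) hWn hc2
  refine MemLp.of_le hdom hgm (Eventually.of_forall fun x => ?_)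
  have hpos : 0 ≤ (|2 * γ - 1| + 2 * ‖G x‖) * ‖selfSimilarTransport γ 0 V x‖ := by positivity
  rw [Real.norm_of_nonneg hpos]
  have e1 : ‖(2 * γ - 1) • innerSL ℝ (selfSimilarTransport γ 0 V x)‖ = |2 * γ - 1| * ‖selfSimilarTransport γ 0 V x‖ := by
    rw [norm_smul, Real.norm_eq_abs, innerSL_apply_norm]
  have e2 : ‖(innerSL ℝ (selfSimilarTransport γ 0 V x)).comp (G x)‖ ≤ ‖selfSimilarTransport γ 0 V x‖ * ‖G x‖ :=
    ((innerSL ℝ (selfSimilarTransport γ 0 V x)).opNorm_comp_le (G x)).trans (by rw [innerSL_apply_norm])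
  have e3 : ‖innerSL ℝ (G x (selfSimilarTransport γ 0 V x))‖ ≤ ‖G x‖ * ‖selfSimilarTransport γ 0 V x‖ := by
    rw [innerSL_apply_norm]; exact (G x).le_opNorm _
  calc ‖(2 * γ - 1) • innerSL ℝ (selfSimilarTransport γ 0 V x) +
          (innerSL ℝ (selfSimilarTransport γ 0 V x)).comp (G x) - innerSL ℝ (G x (selfSimilarTransport γ 0 V x))‖
        ≤ ‖(2 * γ - 1) • innerSL ℝ (selfSimilarTransport γ 0 V x)‖ +
            ‖(innerSL ℝ (selfSimilarTransport γ 0 V x)).comp (G x)‖ + ‖innerSL ℝ (G x (selfSimilarTransport γ 0 V x))‖ :=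
          norm_sub_le_of_le (norm_add_le _ _) le_rfl
    _ ≤ |2 * γ - 1| * ‖selfSimilarTransport γ 0 V x‖ + ‖selfSimilarTransport γ 0 V x‖ * ‖G x‖ +
          ‖G x‖ * ‖selfSimilarTransport γ 0 V x‖ := by rw [e1]; gcongr
    _ = (|2 * γ - 1| + 2 * ‖G x‖) * ‖selfSimilarTransport γ 0 V x‖ := by ring

/-- `W = γy + V` is locally integrable when `V` is. [folklore] -/
theorem locallyIntegrable_transport {γ : ℝ} (hVl : LocallyIntegrable V volume) :
    LocallyIntegrable (selfSimilarTransport γ 0 V) volume := by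
  have h := ((by fun_prop : Continuous fun x : EuclideanSpace ℝ (Fin 3) => γ • (x - 0)).locallyIntegrable
    (μ := volume)).add hVl
  have e : ((fun x : EuclideanSpace ℝ (Fin 3) => γ • (x - 0)) + V) = selfSimilarTransport γ 0 V := by
    funext x; rfl
  rwa [e] at h

end Integrability

/-! ## The renormalised transport law -/

section Law

/-- The Lamb-form gradient applied to `W` itself: `(2γ−1)⟪W,W⟫ + ⟪W, G W⟫ − ⟪G W, W⟫ = (2γ−1)|W|²` (the two transport
terms cancel by symmetry of the real inner product) — the pointwise identity `W·∇ℋ = (2γ−1)|W|²` (CIV (3.31)).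
[folklore; cf. ConstantinIgnatovaVicol2026Putative §3.4.3 (3.31)] -/
theorem bernoulliGradient_apply_transport (γ : ℝ) (x : EuclideanSpace ℝ (Fin 3)) :
    ((2 * γ - 1) • innerSL ℝ (selfSimilarTransport γ 0 V x) + (innerSL ℝ (selfSimilarTransport γ 0 V x)).comp (G x) -
        innerSL ℝ (G x (selfSimilarTransport γ 0 V x))) (selfSimilarTransport γ 0 V x) =
      (2 * γ - 1) * ‖selfSimilarTransport γ 0 V x‖ ^ 2 := by
  rw [_root_.sub_apply, _root_.add_apply, _root_.smul_apply, ContinuousLinearMap.comp_apply, innerSL_apply_apply,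
    innerSL_apply_apply, innerSL_apply_apply, real_inner_self_eq_norm_sq, smul_eq_mul,
    real_inner_comm (selfSimilarTransport γ 0 V x) ((G x) (selfSimilarTransport γ 0 V x))]
  ring

/-- **THE RENORMALISED SIMILARITY-BERNOULLI TRANSPORT LAW IN THE WEAK CLASS.**  Let `V ∈ L⁶(B(0,r))` for every `r`, with
whole-space weak gradient `G`, `G ∈ L²(B(0,r))` for every `r`, weakly divergence free, let `P ∈ L^{3/2}(B(0,r))` for every
`r`, and let the similarity-Bernoulli function `ℋ = selfSimilarBernoulli γ 0 V P` have the Lamb-form weak gradient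
`Dℋ(x) v = (2γ−1)⟪W x, v⟫ + ⟪W x, G x v⟫ − ⟪G x (W x), v⟫` on `ℝ³` (the conclusion of g6's
`WeakBernoulli.hasWeakFDerivOn_bernoulli`; `W = selfSimilarTransport γ 0 V`).  Then for every `β ∈ C¹(ℝ)` with
`‖β′‖_∞ ≤ L` and every test function `θ`:

  `∫ β(ℋ) ⟪W, ∇θ⟫ = −3γ ∫ θ β(ℋ) + (1 − 2γ) ∫ θ β′(ℋ) |W|²`,

i.e. `div(β(ℋ) W) = 3γ β(ℋ) − (1−2γ) β′(ℋ) |W|²` in `𝒟′(ℝ³)` (chain rule on a ball `B ⊇ supp θ` where `ℋ, ∇ℋ ∈ L^{3/2}(B)`,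
product rule `integral_mul_inner_transport_gradient`, pointwise `∇ℋ·W = (2γ−1)|W|²`); NO regularity of the profile.
[folklore; cf. ConstantinIgnatovaVicol2026Putative §3.4.3 (3.31); Evans2010 §5.10 Problem 17] -/
theorem renormalized_transport_law {γ : ℝ}
    (hV6 : ∀ r : ℝ, MemLp V 6 (volume.restrict (ball (0 : EuclideanSpace ℝ (Fin 3)) r)))
    (hG2 : ∀ r : ℝ, MemLp G 2 (volume.restrict (ball (0 : EuclideanSpace ℝ (Fin 3)) r)))
    (hP32 : ∀ r : ℝ, MemLp P (3 / 2 : ℝ≥0∞) (volume.restrict (ball (0 : EuclideanSpace ℝ (Fin 3)) r)))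
    (hdiv : IsWeaklyDivFree V)
    (hH : HasWeakFDerivOn (⊤ : Opens (EuclideanSpace ℝ (Fin 3))) volume (selfSimilarBernoulli γ 0 V P)
      (fun x => (2 * γ - 1) • innerSL ℝ (selfSimilarTransport γ 0 V x) +
        (innerSL ℝ (selfSimilarTransport γ 0 V x)).comp (G x) - innerSL ℝ (G x (selfSimilarTransport γ 0 V x))))
    {β : ℝ → ℝ} (hβ : ContDiff ℝ 1 β) {L : ℝ} (hL : ∀ z, ‖deriv β z‖ ≤ L)
    {θ : EuclideanSpace ℝ (Fin 3) → ℝ} (hθ : IsTestFunctionOn (⊤ : Opens (EuclideanSpace ℝ (Fin 3))) θ) :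
    ∫ x, β (selfSimilarBernoulli γ 0 V P x) * ⟪selfSimilarTransport γ 0 V x, gradient θ x⟫ =
      -(3 * γ) * (∫ x, θ x * β (selfSimilarBernoulli γ 0 V P x)) +
        (1 - 2 * γ) * ∫ x, θ x * (deriv β (selfSimilarBernoulli γ 0 V P x) * ‖selfSimilarTransport γ 0 V x‖ ^ 2) := by
  -- ### a ball around the support
  obtain ⟨R₀, hR₀⟩ := hθ.hasCompactSupport.isCompact.isBounded.subset_ball (0 : EuclideanSpace ℝ (Fin 3))
  set R : ℝ := max R₀ 1 with hRdef
  have hKB : tsupport θ ⊆ ball (0 : EuclideanSpace ℝ (Fin 3)) R := hR₀.trans (ball_subset_ball (le_max_left _ _))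
  have hθU : IsTestFunctionOn (⟨ball (0 : EuclideanSpace ℝ (Fin 3)) R, isOpen_ball⟩ : Opens (EuclideanSpace ℝ (Fin 3))) θ :=
    ⟨hθ.contDiff, hθ.hasCompactSupport, hKB⟩
  haveI : IsFiniteMeasure ((volume : Measure (EuclideanSpace ℝ (Fin 3))).restrict (ball 0 R)) :=
    isFiniteMeasure_restrict.2 measure_ball_lt_top.ne
  set Hb : EuclideanSpace ℝ (Fin 3) → ℝ := selfSimilarBernoulli γ 0 V P with hHb
  set W : EuclideanSpace ℝ (Fin 3) → EuclideanSpace ℝ (Fin 3) := selfSimilarTransport γ 0 V with hWdef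
  set gH : EuclideanSpace ℝ (Fin 3) → EuclideanSpace ℝ (Fin 3) →L[ℝ] ℝ := fun x =>
    (2 * γ - 1) • innerSL ℝ (W x) + (innerSL ℝ (W x)).comp (G x) - innerSL ℝ (G x (W x)) with hgH
  have hL0 : 0 ≤ L := (norm_nonneg _).trans (hL 0)
  have hβc : Continuous β := hβ.continuous
  have hβ'c : Continuous (deriv β) := hβ.continuous_deriv le_rfl
  have hθc : Continuous θ := hθ.contDiff.continuous
  have hθK : ∀ x, x ∉ ball (0 : EuclideanSpace ℝ (Fin 3)) R → θ x = 0 := fun x hx =>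
    image_eq_zero_of_notMem_tsupport fun h' => hx (hKB h')
  obtain ⟨C₀, hC₀⟩ := hθc.bounded_above_of_compact_support hθ.hasCompactSupport
  -- ### data on the ball
  have hHU : HasWeakFDerivOn (⟨ball (0 : EuclideanSpace ℝ (Fin 3)) R, isOpen_ball⟩ : Opens (EuclideanSpace ℝ (Fin 3))) volume Hb gH :=
    HasWeakFDerivOn.mono_set_holds hH le_top
  have hH32 : MemLp Hb (3 / 2 : ℝ≥0∞) (volume.restrict (ball (0 : EuclideanSpace ℝ (Fin 3)) R)) :=
    memLp_bernoulli_threeHalves (hV6 R) (hP32 R)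
  have hgm : AEStronglyMeasurable gH (volume.restrict (ball (0 : EuclideanSpace ℝ (Fin 3)) R)) :=
    hHU.locallyIntegrableOn_deriv.aestronglyMeasurable
  have hg32 : MemLp gH (3 / 2 : ℝ≥0∞) (volume.restrict (ball (0 : EuclideanSpace ℝ (Fin 3)) R)) :=
    memLp_bernoulliGradient_threeHalves (hV6 R) (hG2 R) hgm
  have hW6 : MemLp W 6 (volume.restrict (ball (0 : EuclideanSpace ℝ (Fin 3)) R)) := memLp_transport_six (hV6 R)
  -- ### the chain rule (tree): `β ∘ ℋ` has the weak derivative `β′(ℋ) ∇ℋ` on the ball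
  have hβH : HasWeakFDerivOn (⟨ball (0 : EuclideanSpace ℝ (Fin 3)) R, isOpen_ball⟩ : Opens (EuclideanSpace ℝ (Fin 3))) volume (fun x => β (Hb x))
      (fun x => deriv β (Hb x) • gH x) :=
    Wu2026Salvage.hasWeakFDerivOn_comp_of_deriv_bound threeHalves_exponent.1 threeHalves_exponent.2
      threeHalves_exponent.1 threeHalves_exponent.2 hHU hH32 hg32 hβ hL
  have hf32 : MemLp (fun x => β (Hb x)) (3 / 2 : ℝ≥0∞) (volume.restrict (ball (0 : EuclideanSpace ℝ (Fin 3)) R)) := by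
    have hd1 : MemLp (fun x => L * ‖Hb x‖) (3 / 2 : ℝ≥0∞) (volume.restrict (ball (0 : EuclideanSpace ℝ (Fin 3)) R)) :=
      hH32.norm.const_mul L
    have hd2 : MemLp (fun _ : EuclideanSpace ℝ (Fin 3) => ‖β 0‖) (3 / 2 : ℝ≥0∞)
        (volume.restrict (ball (0 : EuclideanSpace ℝ (Fin 3)) R)) := memLp_const _
    have hdom : MemLp (fun x => L * ‖Hb x‖ + ‖β 0‖) (3 / 2 : ℝ≥0∞) (volume.restrict (ball (0 : EuclideanSpace ℝ (Fin 3)) R)) :=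
      hd1.add hd2
    refine MemLp.of_le hdom (hβc.comp_aestronglyMeasurable hH32.1) (Eventually.of_forall fun x => ?_)
    have h := Wu2026Salvage.abs_sub_le_of_deriv_bound hβ hL (Hb x) 0
    rw [sub_zero] at h
    have hnn : 0 ≤ L * ‖Hb x‖ + ‖β 0‖ := add_nonneg (mul_nonneg hL0 (norm_nonneg _)) (norm_nonneg _)
    rw [Real.norm_of_nonneg hnn, Real.norm_eq_abs, Real.norm_eq_abs, Real.norm_eq_abs]
    calc |β (Hb x)| = |β (Hb x) - β 0 + β 0| := by rw [sub_add_cancel]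
      _ ≤ |β (Hb x) - β 0| + |β 0| := abs_add_le _ _
      _ ≤ L * |Hb x| + |β 0| := by gcongr
  have hfg32 : MemLp (fun x => deriv β (Hb x) • gH x) (3 / 2 : ℝ≥0∞) (volume.restrict (ball (0 : EuclideanSpace ℝ (Fin 3)) R)) := by
    refine MemLp.of_le_mul hg32 ((hβ'c.comp_aestronglyMeasurable hH32.1).smul hgm) (c := L)
      (Eventually.of_forall fun x => ?_)
    rw [norm_smul]
    exact mul_le_mul_of_nonneg_right (hL _) (norm_nonneg _)
  have hmain := integral_mul_inner_transport_gradient (γ := γ) hβH hf32 hfg32 (hV6 R) hdiv hθU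
  -- ### pointwise: `(β′(ℋ) ∇ℋ)·W = (2γ−1) β′(ℋ) |W|²`
  have hpt : ∀ x, θ x * ((deriv β (Hb x) • gH x) (W x) + 3 * γ * β (Hb x)) =
      (2 * γ - 1) * (θ x * (deriv β (Hb x) * ‖W x‖ ^ 2)) + 3 * γ * (θ x * β (Hb x)) := by
    intro x
    rw [_root_.smul_apply, smul_eq_mul, hgH, hWdef, bernoulliGradient_apply_transport γ x]
    ring
  have hIθβ : Integrable (fun x => θ x * β (Hb x)) volume := by
    have h := SobolevApprox.integrableOn_testFunction_smul hθU hβH.locallyIntegrableOn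
    simp only [smul_eq_mul] at h
    exact h.integrable_of_forall_notMem_eq_zero fun x hx => by rw [hθK x hx, zero_mul]
  have hIW2 : IntegrableOn (fun x => ‖W x‖ ^ 2) (ball (0 : EuclideanSpace ℝ (Fin 3)) R) volume :=
    (memLp_two_iff_integrable_sq_norm hW6.1).1 (hW6.mono_exponent (by norm_num))
  have hIθβ'W : Integrable (fun x => θ x * (deriv β (Hb x) * ‖W x‖ ^ 2)) volume := by
    have h : IntegrableOn (fun x => θ x * (deriv β (Hb x) * ‖W x‖ ^ 2)) (ball (0 : EuclideanSpace ℝ (Fin 3)) R) volume := by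
      refine Integrable.mono' (hIW2.const_mul (C₀ * L))
        ((hθc.aestronglyMeasurable.restrict).mul
          (((hβ'c.comp_aestronglyMeasurable hH32.1)).mul (hW6.1.norm.pow 2)))
        (Eventually.of_forall fun x => ?_)
      rw [norm_mul, norm_mul, norm_pow, norm_norm]
      calc ‖θ x‖ * (‖deriv β (Hb x)‖ * ‖W x‖ ^ 2) ≤ C₀ * (L * ‖W x‖ ^ 2) :=
            mul_le_mul (hC₀ x) (mul_le_mul_of_nonneg_right (hL _) (by positivity)) (by positivity)
              ((norm_nonneg _).trans (hC₀ x))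
        _ = C₀ * L * ‖W x‖ ^ 2 := by ring
    exact h.integrable_of_forall_notMem_eq_zero fun x hx => by rw [hθK x hx, zero_mul]
  rw [hmain, integral_congr_ae (Eventually.of_forall hpt), integral_add (hIθβ'W.const_mul _) (hIθβ.const_mul _),
    integral_const_mul, integral_const_mul]
  ring

/-- **One-sided renormalised law**: `γ ≤ ½`, `β′ ≥ 0`, `θ ≥ 0` ⇒ `−3γ ∫ θ β(ℋ) ≤ ∫ β(ℋ) ⟪W, ∇θ⟫`. [folklore] -/
theorem renormalized_transport_ineq {γ : ℝ} (hγ : γ ≤ 1 / 2)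
    (hV6 : ∀ r : ℝ, MemLp V 6 (volume.restrict (ball (0 : EuclideanSpace ℝ (Fin 3)) r)))
    (hG2 : ∀ r : ℝ, MemLp G 2 (volume.restrict (ball (0 : EuclideanSpace ℝ (Fin 3)) r)))
    (hP32 : ∀ r : ℝ, MemLp P (3 / 2 : ℝ≥0∞) (volume.restrict (ball (0 : EuclideanSpace ℝ (Fin 3)) r)))
    (hdiv : IsWeaklyDivFree V)
    (hH : HasWeakFDerivOn (⊤ : Opens (EuclideanSpace ℝ (Fin 3))) volume (selfSimilarBernoulli γ 0 V P)
      (fun x => (2 * γ - 1) • innerSL ℝ (selfSimilarTransport γ 0 V x) +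
        (innerSL ℝ (selfSimilarTransport γ 0 V x)).comp (G x) - innerSL ℝ (G x (selfSimilarTransport γ 0 V x))))
    {β : ℝ → ℝ} (hβ : ContDiff ℝ 1 β) {L : ℝ} (hL : ∀ z, ‖deriv β z‖ ≤ L) (hβ' : ∀ z, 0 ≤ deriv β z)
    {θ : EuclideanSpace ℝ (Fin 3) → ℝ} (hθ : IsTestFunctionOn (⊤ : Opens (EuclideanSpace ℝ (Fin 3))) θ)
    (hθ0 : ∀ x, 0 ≤ θ x) :
    -(3 * γ) * (∫ x, θ x * β (selfSimilarBernoulli γ 0 V P x)) ≤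
      ∫ x, β (selfSimilarBernoulli γ 0 V P x) * ⟪selfSimilarTransport γ 0 V x, gradient θ x⟫ := by
  rw [renormalized_transport_law hV6 hG2 hP32 hdiv hH hβ hL hθ]
  have h : 0 ≤ ∫ x, θ x * (deriv β (selfSimilarBernoulli γ 0 V P x) * ‖selfSimilarTransport γ 0 V x‖ ^ 2) :=
    integral_nonneg fun x => mul_nonneg (hθ0 x) (mul_nonneg (hβ' _) (by positivity))
  nlinarith

end Law

/-! ## The high sets are backward-invariant (Eulerian form) -/

section HighSet

/-- **«THE BERNOULLI HIGH SETS ARE BACKWARD-INVARIANT» — EULERIAN FORM, NO REGULARITY, NO FLOW.**  Under the hypotheses of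
`renormalized_transport_law` with `γ ≤ ½`, for every level `h` and every NONNEGATIVE test function `θ`:

  `−3γ ∫_{ℋ > h} θ ≤ ∫_{ℋ > h} ⟪W, ∇θ⟫`,

i.e. `div(𝟙_{ℋ > h} W) ≤ 𝟙_{ℋ > h} div W` in `𝒟′(ℝ³)`: the distributional form of «backward similarity orbits starting in `{ℋ > h}`
stay in `{ℋ > h}`» (one-sided renormalised law for the steps `S((n+1)(·−h)) ↑ 𝟙_{(h,∞)}` + dominated convergence).
[folklore; cf. ConstantinIgnatovaVicol2026Putative §3.4.3 (3.31)–(3.33)] -/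
theorem highSet_transport_ineq {γ : ℝ} (hγ : γ ≤ 1 / 2)
    (hV6 : ∀ r : ℝ, MemLp V 6 (volume.restrict (ball (0 : EuclideanSpace ℝ (Fin 3)) r)))
    (hG2 : ∀ r : ℝ, MemLp G 2 (volume.restrict (ball (0 : EuclideanSpace ℝ (Fin 3)) r)))
    (hP32 : ∀ r : ℝ, MemLp P (3 / 2 : ℝ≥0∞) (volume.restrict (ball (0 : EuclideanSpace ℝ (Fin 3)) r)))
    (hdiv : IsWeaklyDivFree V)
    (hH : HasWeakFDerivOn (⊤ : Opens (EuclideanSpace ℝ (Fin 3))) volume (selfSimilarBernoulli γ 0 V P)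
      (fun x => (2 * γ - 1) • innerSL ℝ (selfSimilarTransport γ 0 V x) +
        (innerSL ℝ (selfSimilarTransport γ 0 V x)).comp (G x) - innerSL ℝ (G x (selfSimilarTransport γ 0 V x))))
    (h : ℝ) {θ : EuclideanSpace ℝ (Fin 3) → ℝ} (hθ : IsTestFunctionOn (⊤ : Opens (EuclideanSpace ℝ (Fin 3))) θ)
    (hθ0 : ∀ x, 0 ≤ θ x) :
    -(3 * γ) * (∫ x in {x | h < selfSimilarBernoulli γ 0 V P x}, θ x) ≤
      ∫ x in {x | h < selfSimilarBernoulli γ 0 V P x}, ⟪selfSimilarTransport γ 0 V x, gradient θ x⟫ := by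
  set Hb : EuclideanSpace ℝ (Fin 3) → ℝ := selfSimilarBernoulli γ 0 V P with hHb
  set W : EuclideanSpace ℝ (Fin 3) → EuclideanSpace ℝ (Fin 3) := selfSimilarTransport γ 0 V with hWdef
  set S : Set (EuclideanSpace ℝ (Fin 3)) := {x | h < Hb x} with hSdef
  have hθc : Continuous θ := hθ.contDiff.continuous
  have hgc : Continuous (gradient θ) :=
    continuous_gradient_of_contDiff (hθ.contDiff.of_le (by exact_mod_cast le_top))
  -- measurability of `ℋ` and of the high set
  have hHl : LocallyIntegrable Hb volume := locallyIntegrableOn_univ.1 (by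
    simpa only [Opens.coe_top] using hH.locallyIntegrableOn)
  have hHm : AEStronglyMeasurable Hb volume := hHl.aestronglyMeasurable
  have hS : NullMeasurableSet S volume := nullMeasurableSet_lt aemeasurable_const hHm.aemeasurable
  -- the two integrable majorants
  have hVl : LocallyIntegrable V volume := WeakBernoulli.locallyIntegrable_of_memLp_six_ball hV6
  have hWl : LocallyIntegrable W volume := locallyIntegrable_transport hVl
  have hIflux : Integrable (fun x => ⟪W x, gradient θ x⟫) volume :=
    integrable_inner_of_locallyIntegrable_of_hasCompactSupport hWl hgc
      (HasCompactSupport.intro hθ.hasCompactSupport fun x hx => gradient_eq_zero_of_notMem_tsupport hx)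
  have hIθ : Integrable θ volume := hθc.integrable_of_hasCompactSupport hθ.hasCompactSupport
  -- the step approximations
  obtain hstep := fun n : ℕ => exists_bound_deriv_levelStep n h
  have hineq : ∀ n : ℕ, -(3 * γ) * (∫ x, θ x * Real.smoothTransition (((n : ℝ) + 1) * (Hb x - h))) ≤
      ∫ x, Real.smoothTransition (((n : ℝ) + 1) * (Hb x - h)) * ⟪W x, gradient θ x⟫ := by
    intro n
    obtain ⟨L, hL⟩ := hstep n
    exact renormalized_transport_ineq hγ hV6 hG2 hP32 hdiv hH (contDiff_levelStep n h) hL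
      (deriv_levelStep_nonneg n h) hθ hθ0
  -- dominated convergence on both sides
  have hlimA : Tendsto (fun n : ℕ => ∫ x, Real.smoothTransition (((n : ℝ) + 1) * (Hb x - h)) * ⟪W x, gradient θ x⟫) atTop
      (𝓝 (∫ x, S.indicator (fun x => ⟪W x, gradient θ x⟫) x)) := by
    refine tendsto_integral_of_dominated_convergence (fun x => ‖⟪W x, gradient θ x⟫‖)
      (fun n => ((continuous_levelStep n h).comp_aestronglyMeasurable hHm).mul hIflux.1) hIflux.norm
      (fun n => Eventually.of_forall fun x => ?_) (Eventually.of_forall fun x => ?_)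
    · rw [norm_mul, Real.norm_of_nonneg (levelStep_nonneg n h _)]
      exact mul_le_of_le_one_left (norm_nonneg _) (levelStep_le_one n h _)
    · have ht := (tendsto_levelStep h (Hb x)).mul_const ⟪W x, gradient θ x⟫
      refine ht.congr' (Eventually.of_forall fun n => rfl) |>.mono_right (le_of_eq ?_)
      congr 1
      by_cases hx : h < Hb x
      · rw [if_pos hx, one_mul, indicator_of_mem (show x ∈ S from hx)]
      · rw [if_neg hx, zero_mul, indicator_of_notMem (show x ∉ S from hx)]
  have hlimB : Tendsto (fun n : ℕ => ∫ x, θ x * Real.smoothTransition (((n : ℝ) + 1) * (Hb x - h))) atTop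
      (𝓝 (∫ x, S.indicator θ x)) := by
    refine tendsto_integral_of_dominated_convergence (fun x => ‖θ x‖)
      (fun n => hIθ.1.mul ((continuous_levelStep n h).comp_aestronglyMeasurable hHm)) hIθ.norm
      (fun n => Eventually.of_forall fun x => ?_) (Eventually.of_forall fun x => ?_)
    · rw [norm_mul, Real.norm_of_nonneg (levelStep_nonneg n h _)]
      exact mul_le_of_le_one_right (norm_nonneg _) (levelStep_le_one n h _)
    · have ht := (tendsto_levelStep h (Hb x)).const_mul (θ x)
      refine ht.mono_right (le_of_eq ?_)
      congr 1
      by_cases hx : h < Hb x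
      · rw [if_pos hx, mul_one, indicator_of_mem (show x ∈ S from hx)]
      · rw [if_neg hx, mul_zero, indicator_of_notMem (show x ∉ S from hx)]
  have hlim := le_of_tendsto_of_tendsto' (hlimB.const_mul (-(3 * γ))) hlimA hineq
  rwa [integral_indicator₀ hS, integral_indicator₀ hS] at hlim

end HighSet

end WeakRenormalized

end Summit.NavierStokesRegularity.NavierStokesRegularity.Theorems.PowerGaugeEulerLiouville
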